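import Summits.HodgeConjecture.CorCM.MumfordTateRankCMThreefoldTimesCMCurves
import Summits.HodgeConjecture.CorCM.MumfordTateRankThreefoldTimesCurves
import HarnessLib

/-!
# The fivefold partition {1,1,3} over a simple CM threefold: `t(T × E₁ × E₂) ∈ {4, 5, 6, 7, 8, 10}` for a simple abelian threefold `T` of CM type
# and ARBITRARY elliptic curves `E₁, E₂`, every cell exact (Moonen–Zarhin 1999 Thm. (0.2), §3 (3.4), (3.8))

COR-CM (cell `pub-hodgecm2`, seat `b27` gen 50, count-neutral Mumford–Tate-rank ladder; theorems only, no definition, no named fact;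
UNCONDITIONAL — nothing here uses or asserts HC_CM).  Notation `t(X) = dim MT(H¹X)`; `K = End⁰T` (a sextic CM field; `t(T) = 4`).

THE TABLE for `X ∼ T × (E₁ × E₂)`:
* both CM                                        : `{4, 5, 6}` (`CorCM/MumfordTateRankCMThreefoldTimesCMCurves`: `6` iff `E₁ ≁ E₂` and neither field
  maps to `K`; `4` iff both fields map to `K`; `5` otherwise);
* `E₁` non-CM, `E₂` CM with `End⁰E₂ ↪ K` / `↛ K` : `7` / `8` (`t(E₂ × T) + 3`, Lemma (3.4));
* both non-CM, isogenous / not                   : `7` / `10` (`+3` per isogeny class).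

* §1 `mtRank_hodge_one_of_isIsogenous_cmThreefold_prod_nonCMCurve_prod_cmCurve` (`7 / 8`), `mtRank_hodge_one_of_isIsogenous_cmThreefold_prod_nonCMCurves`
  (`7 / 10`);
* §2 **`mtRank_hodge_one_mem_of_isIsogenous_cmThreefold_prod_curves`** — `t(T × E₁ × E₂) ∈ {4, 5, 6, 7, 8, 10}` for all curves.

## References
* [MoonenZarhin1999LowDim] B. Moonen, Yu. G. Zarhin, *Hodge classes on abelian varieties of low dimension*, Math. Ann. 315 (1999), Thm. (0.2), §2 (2.3),
  §3 (3.1), Lemma (3.4), Prop. (3.8) [corpus: paper:arxiv-math_9901113 pp. 1–2, 5–7]. [cite: MoonenZarhin1999LowDim, §3 (3.4) and (3.8)]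
* [Gordon1999HodgeAVSurvey] B. B. Gordon, *A survey of the Hodge conjecture for abelian varieties*, §3 Theorem (Imai), 7.5–7.7, 9.1.
  [cite: Gordon1999HodgeAVSurvey, §3 Theorem (Imai) and 7.6.1]
* [MumfordAV1970] D. Mumford, *Abelian Varieties* (1970), §19 Cor. 2 of Thm. 1. [cite: MumfordAV1970, §19 Cor. 2 of Thm. 1]
-/

noncomputable section

open CategoryTheory CategoryTheory.Limits Module

namespace Summit.HodgeConjecture.CorCM

open Literature.AlgebraicGeometry.Motives
open Literature.AlgebraicGeometry.Motives.AbelianVariety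
open Literature.AlgebraicGeometry.Motives.HodgeStructure
open Literature.AlgebraicGeometry.HodgeTheory
open Literature.AlgebraicGeometry.Milne1999 (IsOfCMType isOfCMType_iff_of_isIsogenous hom_eq_zero_of_isSimple_of_not_isIsogenous)

variable [HodgeTensorFacts.{0, 0}] {X T E₁ E₂ : AbelianVariety ℂ} {n : ℕ}

/-- A simple abelian threefold of CM type has `t(T) = 4` (the threefold table: `t ∈ {22, 10, 10, 4}` and `t ≤ dim T + 1` for a CM variety).
[cite: MoonenZarhin1999LowDim, §2 (2.3)] [cite: Gordon1999HodgeAVSurvey, 7.5 and 9.1] -/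
theorem mtRank_hodge_one_eq_four_of_isSimple_cmThreefold {k : ℕ} (hT : IsSmoothProjective k T.X) (hTs : T.IsSimple) (hT3 : T.dim = 3)
    (hTcm : IsOfCMType T) :
    haveI := BettiUniverse.finite hT 1
    (BettiUniverse.hodge exists_isReal_hodgeModel_holds hT 1).mtRank = 4 := by
  have hle := mtRank_hodge_one_le_dim_add_one_of_isOfCMType hT (by omega) hTcm
  rcases mtRank_hodge_one_of_isSimple_threefold hT hTs hT3 with ⟨-, h⟩ | ⟨-, h⟩ | ⟨-, h⟩ | ⟨-, -, h⟩ <;> omega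

/-! ## §1 A non-CM curve and a CM curve; two non-CM curves -/

/-- **`t(T × E₁ × E₂) = t(E₂ × T) + 3` for a non-CM curve `E₁` and a CM curve `E₂` over a simple CM threefold `T`**: `Hom(E₂ × T, E₁) = 0` and
Lemma (3.4); hence `7` if `End⁰E₂ ↪ End⁰T`, `8` if not (`t(E₂ × T) = 4 / 5`, `CorCM/MumfordTateRankCMCurveTimesCMThreefold`).
[cite: MoonenZarhin1999LowDim, §3 (3.4) and (3.8)] -/
theorem mtRank_hodge_one_of_isIsogenous_cmThreefold_prod_nonCMCurve_prod_cmCurve (hX : IsSmoothProjective n X.X)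
    (hTs : T.IsSimple) (hT3 : T.dim = 3) (hTcm : IsOfCMType T)
    (hE₁1 : E₁.dim = 1) (hE₁cm : ¬ IsOfCMType E₁) (hE₂1 : E₂.dim = 1) (hE₂cm : IsOfCMType E₂) (hXP : IsIsogenous X (T.prod (E₁.prod E₂))) :
    haveI := BettiUniverse.finite hX 1
    (Nonempty (E₂.endAlgebra →+* T.endAlgebra) ∧ (BettiUniverse.hodge exists_isReal_hodgeModel_holds hX 1).mtRank = 7) ∨
      (IsEmpty (E₂.endAlgebra →+* T.endAlgebra) ∧ (BettiUniverse.hodge exists_isReal_hodgeModel_holds hX 1).mtRank = 8) := by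
  haveI := BettiUniverse.finite hX 1
  have hY : IsSmoothProjective (E₂.prod T).dim (E₂.prod T).X := AbelianVariety.isSmoothProjective_holds
  haveI := BettiUniverse.finite hY 1
  have hXQ : IsIsogenous X (E₁.prod (E₂.prod T)) :=
    (hXP.trans (Literature.AlgebraicGeometry.HodgeTheory.isIsogenous_prod_assoc T E₁ E₂).symm').trans
      (((isIsogenous_prod_comm T E₁).prod (IsIsogenous.refl E₂)).trans
        ((Literature.AlgebraicGeometry.HodgeTheory.isIsogenous_prod_assoc E₁ T E₂).trans
          ((IsIsogenous.refl E₁).prod (isIsogenous_prod_comm T E₂))))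
  have hYE : ∀ w : E₂.prod T ⟶ E₁, w = 0 :=
    forall_hom_prod_eq_zero
      (fun v => hom_eq_zero_of_isSimple_of_not_isIsogenous (isSimple_of_dim_le_one hE₂1.le) (isSimple_of_dim_le_one hE₁1.le)
        (fun h => hE₁cm ((isOfCMType_iff_of_isIsogenous h).1 hE₂cm)) v)
      (hom_eq_zero_of_isSimple_of_dim_ne hTs (isSimple_of_dim_le_one hE₁1.le) (by omega))
  have h3 := mtRank_hodge_one_eq_add_three_of_isIsogenous_nonCMCurve_prod hX hY (by rw [dim_prod]; omega) hE₁1 hE₁cm hYE hXQ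
  by_cases hf : Nonempty (E₂.endAlgebra →+* T.endAlgebra)
  · have h4 := (mtRank_hodge_one_eq_four_iff_nonempty_ringHom_of_isIsogenous_cmCurve_prod_isSimple_cmThreefold hY hE₂1 hE₂cm hTs hT3 hTcm
      (IsIsogenous.refl _)).2 hf
    exact Or.inl ⟨hf, by omega⟩
  · rw [not_nonempty_iff] at hf
    have h5 := (mtRank_hodge_one_eq_five_iff_isEmpty_ringHom_of_isIsogenous_cmCurve_prod_isSimple_cmThreefold hY hE₂1 hE₂cm hTs hT3 hTcm
      (IsIsogenous.refl _)).2 hf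
    exact Or.inr ⟨hf, by omega⟩

/-- **Two non-CM curves over a simple CM threefold: `t(T × E₁ × E₂) = 7` if `E₁ ∼ E₂`, `10` if not** (`t(T) = 4`, `+3` per isogeny class of non-CM
curves). [cite: MoonenZarhin1999LowDim, §3 (3.4) and (3.8)] [cite: Gordon1999HodgeAVSurvey, §3 Theorem (Imai) and 7.6.1] -/
theorem mtRank_hodge_one_of_isIsogenous_cmThreefold_prod_nonCMCurves (hX : IsSmoothProjective n X.X)
    (hTs : T.IsSimple) (hT3 : T.dim = 3) (hTcm : IsOfCMType T)
    (hE₁1 : E₁.dim = 1) (hE₁cm : ¬ IsOfCMType E₁) (hE₂1 : E₂.dim = 1) (hE₂cm : ¬ IsOfCMType E₂) (hXP : IsIsogenous X (T.prod (E₁.prod E₂))) :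
    haveI := BettiUniverse.finite hX 1
    (IsIsogenous E₁ E₂ ∧ (BettiUniverse.hodge exists_isReal_hodgeModel_holds hX 1).mtRank = 7) ∨
      (¬ IsIsogenous E₁ E₂ ∧ (BettiUniverse.hodge exists_isReal_hodgeModel_holds hX 1).mtRank = 10) := by
  haveI := BettiUniverse.finite hX 1
  have hT : IsSmoothProjective T.dim T.X := AbelianVariety.isSmoothProjective_holds
  have hY : IsSmoothProjective (E₂.prod T).dim (E₂.prod T).X := AbelianVariety.isSmoothProjective_holds
  haveI := BettiUniverse.finite hT 1
  haveI := BettiUniverse.finite hY 1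
  have h4 := mtRank_hodge_one_eq_four_of_isSimple_cmThreefold hT hTs hT3 hTcm
  have hTE₁ : ∀ u : T ⟶ E₁, u = 0 := hom_eq_zero_of_isSimple_of_dim_ne hTs (isSimple_of_dim_le_one hE₁1.le) (by omega)
  have hTE₂ : ∀ u : T ⟶ E₂, u = 0 := hom_eq_zero_of_isSimple_of_dim_ne hTs (isSimple_of_dim_le_one hE₂1.le) (by omega)
  have h7 : (BettiUniverse.hodge exists_isReal_hodgeModel_holds hY 1).mtRank = 7 := by
    have h := mtRank_hodge_one_eq_add_three_of_isIsogenous_nonCMCurve_prod hY hT (by omega) hE₂1 hE₂cm hTE₂ (IsIsogenous.refl _)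
    omega
  by_cases h12 : IsIsogenous E₁ E₂
  · have hXQ : IsIsogenous X ((T.prod E₂).prod E₂) :=
      (hXP.trans ((IsIsogenous.refl T).prod (h12.prod (IsIsogenous.refl E₂)))).trans
        (Literature.AlgebraicGeometry.HodgeTheory.isIsogenous_prod_assoc T E₂ E₂).symm'
    have hdup := mtRank_hodge_one_eq_of_isIsogenous_prod_prod_self hX hY (by rw [dim_prod]; omega) hXQ (isIsogenous_prod_comm E₂ T)
    exact Or.inl ⟨h12, by omega⟩
  · have hXQ : IsIsogenous X (E₁.prod (E₂.prod T)) :=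
      (hXP.trans (Literature.AlgebraicGeometry.HodgeTheory.isIsogenous_prod_assoc T E₁ E₂).symm').trans
        (((isIsogenous_prod_comm T E₁).prod (IsIsogenous.refl E₂)).trans
          ((Literature.AlgebraicGeometry.HodgeTheory.isIsogenous_prod_assoc E₁ T E₂).trans
            ((IsIsogenous.refl E₁).prod (isIsogenous_prod_comm T E₂))))
    have hYE : ∀ w : E₂.prod T ⟶ E₁, w = 0 :=
      forall_hom_prod_eq_zero
        (fun v => hom_eq_zero_of_isSimple_of_not_isIsogenous (isSimple_of_dim_le_one hE₂1.le) (isSimple_of_dim_le_one hE₁1.le)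
          (fun h => h12 h.symm') v) hTE₁
    have h3 := mtRank_hodge_one_eq_add_three_of_isIsogenous_nonCMCurve_prod hX hY (by rw [dim_prod]; omega) hE₁1 hE₁cm hYE hXQ
    exact Or.inr ⟨h12, by omega⟩

/-! ## §2 The assembled table -/

/-- **The fivefold partition {1,1,3} over a simple CM threefold: `t(T × E₁ × E₂) ∈ {4, 5, 6, 7, 8, 10}` for a simple abelian threefold `T` of CM
type and ARBITRARY elliptic curves `E₁`, `E₂`** (`Hg(T) = U_K` of rank `3`; a CM curve adds `0` or `1` by its field, a non-CM curve adds `3` per isogeny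
class). [cite: MoonenZarhin1999LowDim, Thm. (0.2), §3 (3.1), (3.4) and (3.8)] [cite: Gordon1999HodgeAVSurvey, 7.5 and 9.1] -/
theorem mtRank_hodge_one_mem_of_isIsogenous_cmThreefold_prod_curves (hX : IsSmoothProjective n X.X)
    (hTs : T.IsSimple) (hT3 : T.dim = 3) (hTcm : IsOfCMType T) (hE₁1 : E₁.dim = 1) (hE₂1 : E₂.dim = 1)
    (hXP : IsIsogenous X (T.prod (E₁.prod E₂))) :
    haveI := BettiUniverse.finite hX 1
    (BettiUniverse.hodge exists_isReal_hodgeModel_holds hX 1).mtRank ∈ ({4, 5, 6, 7, 8, 10} : Finset ℕ) := by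
  haveI := BettiUniverse.finite hX 1
  have hXP' : IsIsogenous X (T.prod (E₂.prod E₁)) := hXP.trans ((IsIsogenous.refl T).prod (isIsogenous_prod_comm E₁ E₂))
  by_cases hc₁ : IsOfCMType E₁
  · by_cases hc₂ : IsOfCMType E₂
    · have h := mtRank_hodge_one_mem_of_isIsogenous_cmThreefold_prod_cmCurves hX hTs hT3 hTcm hE₁1 hc₁ hE₂1 hc₂ hXP
      simp only [Finset.mem_insert, Finset.mem_singleton] at h ⊢
      omega
    · simp only [Finset.mem_insert, Finset.mem_singleton]
      rcases mtRank_hodge_one_of_isIsogenous_cmThreefold_prod_nonCMCurve_prod_cmCurve hX hTs hT3 hTcm hE₂1 hc₂ hE₁1 hc₁ hXP' with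
        ⟨-, h⟩ | ⟨-, h⟩ <;> omega
  · simp only [Finset.mem_insert, Finset.mem_singleton]
    by_cases hc₂ : IsOfCMType E₂
    · rcases mtRank_hodge_one_of_isIsogenous_cmThreefold_prod_nonCMCurve_prod_cmCurve hX hTs hT3 hTcm hE₁1 hc₁ hE₂1 hc₂ hXP with
        ⟨-, h⟩ | ⟨-, h⟩ <;> omega
    · rcases mtRank_hodge_one_of_isIsogenous_cmThreefold_prod_nonCMCurves hX hTs hT3 hTcm hE₁1 hc₁ hE₂1 hc₂ hXP with ⟨-, h⟩ | ⟨-, h⟩ <;> omega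

end Summit.HodgeConjecture.CorCM

end
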